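import Literature.Analysis.FluidPDE.Seregin2019LocalWeakL3
import Literature.Analysis.FluidPDE.SuitableWeakRescaling
import Literature.Analysis.FluidPDE.LocalTypeIReverseTools
import Literature.Analysis.FluidPDE.LocalTypeIWeakSerrinProofs
import HarnessLib

/-!
# Seregin 2019, Prop. 1.4 at an arbitrary viscosity

Analysis/FluidPDE proof file (theorems only, no definitions, no named facts), companion of
`Seregin2019LocalWeakL3.lean`. The named fact
`seregin2019_localWeakL3_epsRegularity` transcribes [Seregin2019, Prop. 1.4] verbatim, at the
printed unit viscosity; here it is transported to the Navier–Stokes equations with viscosity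
`ν > 0` by the scaling `v(s, y) = ν⁻¹u(s/ν, y)` of the module docstring of the fact file, in the
shape consumed downstream: over the tree predicate `IsSuitableWeakSolutionOn` on the open
parabolic ball at viscosity `ν`, with the two global-class clauses of Seregin's Def. 1.1
(`u ∈ L_{2,∞}`, `p ∈ L_{3/2}` on `Q(z₀,R)`) spelled out, the mean-free pressure quantity
`D₀ = cknDOsc`, the dissipation `E = cknE` of a weak gradient, the local weak-`L³` class in
distribution form, the top slice tied by weak left-continuity in `L²(B(x₀,R))`, the density
hypothesis at one radius `0 < r ≤ R/2` and the conclusion on `Q(z₀, εr)` — all VERBATIM the unit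
viscosity corollary `seregin2019_localWeakL3_epsRegularity.of_suitableWeakOn` with `1 ↦ ν`:

* `seregin2019_localWeakL3_epsRegularity.of_suitableWeakOn_viscosity`.

Mechanism (CKN 1982, §2; ESŠ 2003, §3 "making obvious scaling"; the fact file's "Viscosity"
note). With `θ = min(1, √ν)`, `R' = θR`, the affine map
`Φ(s, y) = (t₀ + (R'²/ν)s, x₀ + R'y)` takes the unit parabolic ball `Q(0,1)` onto the `ν`-cylinder
`]t₀ − R'²/ν, t₀[ × B(x₀, R') ⊆ Q(z₀, R)`, and `v = (R'/ν)·u ∘ Φ`, `q = (R'/ν)²·p ∘ Φ` is a suitable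
weak solution with viscosity `1` on `Q(0,1)` (`IsSuitableWeakSolutionOn.stRescale`) in the class
`IsSuitableWeakSolutionInBall 1 0` with `E ≤ (νθ)⁻¹N`, `D₀ ≤ 4(νθ)⁻²N` (the ball mean over
`B(x₀,R)` serves as a gauge: `cknDOsc_sub_fun_time`, `cknDOsc_le_four_mul_cknD`), weak-`L³` class
bound `M/ν`, its top slice `v(0) = (R'/ν)u(t₀, x₀ + R'·)` the weak left limit in `L²(B(0,1))`;
a density hypothesis for `u(t₀)` at radius `r` with threshold parameter `εκ`,
`κ = min(ν√ν, 1/√ν)`, implies the one for `v(0)` at radius `r/R` with parameter `ε`, and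
boundedness of `v` on `Q(0, εr/R)` is boundedness of `u` on
`]t₀ − θ²ε²r²/ν, t₀[ × B(x₀, θεr) ⊇ Q(z₀, εκr)`. Hence the printed `ε(M,N)` yields
`ε(M,N;ν) = κ · ε(M/ν, (4(νθ)⁻² + (νθ)⁻¹)N)` at viscosity `ν`.

## References

* G. Seregin, arXiv:1906.06707 (2019) = St. Petersburg Math. J. 32 (2021) 565–576, Prop. 1.4.
  [Seregin2019]
* L. Caffarelli, R. Kohn, L. Nirenberg, Comm. Pure Appl. Math. 35 (1982), §2 (scaling of the
  suitable weak class and of `E`, `D`). [CaffarelliKohnNirenberg1982]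
-/

noncomputable section

open MeasureTheory Set Function Metric Filter
open _root_.Topology
open scoped ENNReal NNReal InnerProductSpace RealInnerProductSpace

namespace Literature.Analysis.FluidPDE

section ViscosityTools

/-- Volume of preimages under the space dilation `y ↦ x₀ + γy` of `ℝ³`, for an ARBITRARY set (the
measurable case is `volume_preimage_space_affine`). [folklore] -/
private theorem volume_preimage_dilate {γ : ℝ} (hγ : 0 < γ)
    (x₀ : EuclideanSpace ℝ (Fin 3)) (B : Set (EuclideanSpace ℝ (Fin 3))) :
    volume ((fun y : EuclideanSpace ℝ (Fin 3) => x₀ + γ • y) ⁻¹' B) =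
      ENNReal.ofReal (γ ^ 3)⁻¹ * volume B := by
  have hme := (spaceAffineHomeomorph hγ.ne' x₀).measurableEmbedding
  have h := hme.map_apply (volume : Measure (EuclideanSpace ℝ (Fin 3))) B
  rw [coe_spaceAffineHomeomorph] at h
  rw [← h, map_space_affine_volume hγ x₀, Measure.smul_apply, smul_eq_mul,
    finrank_euclideanSpace_fin]

/-- Superlevel sets of a dilated slice inside a ball: for `α, γ > 0`,
`|{y ∈ B(0,ρ) : a < ‖α f(x₀ + γy)‖}| = γ⁻³ |{x ∈ B(x₀, γρ) : a/α < ‖f x‖}|`. [folklore] -/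
private theorem restrict_ball_superlevel_dilate {α γ : ℝ} (hα : 0 < α) (hγ : 0 < γ)
    (x₀ : EuclideanSpace ℝ (Fin 3)) (f : EuclideanSpace ℝ (Fin 3) → EuclideanSpace ℝ (Fin 3))
    (a ρ : ℝ) :
    (volume.restrict (ball (0 : EuclideanSpace ℝ (Fin 3)) ρ))
        {y : EuclideanSpace ℝ (Fin 3) | a < ‖α • f (x₀ + γ • y)‖} =
      ENNReal.ofReal (γ ^ 3)⁻¹ *
        (volume.restrict (ball x₀ (γ * ρ))) {x : EuclideanSpace ℝ (Fin 3) | a / α < ‖f x‖} := by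
  rw [Measure.restrict_apply' measurableSet_ball, Measure.restrict_apply' measurableSet_ball]
  have hset : {y : EuclideanSpace ℝ (Fin 3) | a < ‖α • f (x₀ + γ • y)‖} ∩ ball 0 ρ =
      (fun y : EuclideanSpace ℝ (Fin 3) => x₀ + γ • y) ⁻¹'
        ({x : EuclideanSpace ℝ (Fin 3) | a / α < ‖f x‖} ∩ ball x₀ (γ * ρ)) := by
    ext y
    constructor
    · rintro ⟨h1, h2⟩
      refine ⟨?_, ?_⟩
      · rw [mem_setOf_eq, norm_smul, Real.norm_eq_abs, abs_of_pos hα] at h1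
        rw [mem_setOf_eq, div_lt_iff₀' hα]
        exact h1
      · rw [mem_ball_zero_iff] at h2
        rw [mem_ball, dist_eq_norm, add_sub_cancel_left, norm_smul, Real.norm_eq_abs, abs_of_pos hγ]
        exact mul_lt_mul_of_pos_left h2 hγ
    · rintro ⟨h1, h2⟩
      refine ⟨?_, ?_⟩
      · rw [mem_setOf_eq, div_lt_iff₀' hα] at h1
        rw [mem_setOf_eq, norm_smul, Real.norm_eq_abs, abs_of_pos hα]
        exact h1
      · rw [mem_ball, dist_eq_norm, add_sub_cancel_left, norm_smul, Real.norm_eq_abs,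
          abs_of_pos hγ] at h2
        rw [mem_ball_zero_iff]
        exact lt_of_mul_lt_mul_left h2 hγ.le
  rw [hset, volume_preimage_dilate hγ]

/-- Essential suprema under the space–time rescaling (cf. the concentration toolkit):
`ess sup_{Φ⁻¹(S)} ‖α u ∘ Φ‖ = |α| · ess sup_S ‖u‖`. [folklore] -/
private theorem eLpNorm_top_smul_stPull_preimage {β γ : ℝ} (hβ : 0 < β) (hγ : 0 < γ) (t₀ : ℝ)
    (x₀ : EuclideanSpace ℝ (Fin 3)) (α : ℝ)
    (u : ℝ → EuclideanSpace ℝ (Fin 3) → EuclideanSpace ℝ (Fin 3))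
    (S : Set (ℝ × EuclideanSpace ℝ (Fin 3))) :
    eLpNorm (uncurry (α • stPull β γ t₀ x₀ u)) ∞ (volume.restrict (stAffine β γ t₀ x₀ ⁻¹' S)) =
      ‖α‖ₑ * eLpNorm (uncurry u) ∞ (volume.restrict S) := by
  have h1 : uncurry (α • stPull β γ t₀ x₀ u) = α • (uncurry u ∘ stAffine β γ t₀ x₀) := by
    funext z
    rfl
  rw [h1, eLpNorm_const_smul]
  congr 1
  rw [← (measurableEmbedding_stAffine hβ.ne' hγ.ne' t₀ x₀).eLpNorm_map_measure,
    map_stAffine_volume_restrict_preimage hβ hγ, eLpNorm_exponent_top, eLpNorm_exponent_top]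
  have hk : ENNReal.ofReal (β * γ ^ Module.finrank ℝ (EuclideanSpace ℝ (Fin 3)))⁻¹ ≠ 0 :=
    (ENNReal.ofReal_pos.2 (by positivity)).ne'
  refine le_antisymm (eLpNormEssSup_mono_measure _ Measure.smul_absolutelyContinuous)
    (eLpNormEssSup_mono_measure _ fun s hs => ?_)
  simp only [Measure.smul_apply, smul_eq_mul, mul_eq_zero] at hs
  exact hs.resolve_left hk

/-- Pairings of a dilated slice against a test field: for `γ > 0`,
`∫ ⟪α f(x₀ + γy), φ(y)⟫ dy = α γ⁻³ ∫ ⟪f x, φ(γ⁻¹(x − x₀))⟫ dx`. [folklore] -/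
private theorem integral_inner_dilate {γ : ℝ} (hγ : 0 < γ) (α : ℝ)
    (x₀ : EuclideanSpace ℝ (Fin 3)) (f φ : EuclideanSpace ℝ (Fin 3) → EuclideanSpace ℝ (Fin 3)) :
    ∫ y, ⟪α • f (x₀ + γ • y), φ y⟫ =
      α * (γ ^ 3)⁻¹ * ∫ x, ⟪f x, φ (γ⁻¹ • (x - x₀))⟫ := by
  have h1 : ∀ y : EuclideanSpace ℝ (Fin 3), ⟪α • f (x₀ + γ • y), φ y⟫ =
      α * ⟪f (x₀ + γ • y), φ (γ⁻¹ • ((x₀ + γ • y) - x₀))⟫ := by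
    intro y
    rw [real_inner_smul_left, add_sub_cancel_left, smul_smul, inv_mul_cancel₀ hγ.ne', one_smul]
  simp_rw [h1]
  rw [integral_const_mul, integral_comp_space_affine hγ x₀
    (fun x => ⟪f x, φ (γ⁻¹ • (x - x₀))⟫), finrank_euclideanSpace_fin, smul_eq_mul, mul_assoc]

/-- `L²` is invariant under affine changes of variable: `φ(γ⁻¹(· − x₀)) ∈ L²` for `φ ∈ L²`,
`γ > 0`. [folklore] -/
private theorem memLp_two_comp_dilate_symm {γ : ℝ} (hγ : 0 < γ) (x₀ : EuclideanSpace ℝ (Fin 3))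
    {φ : EuclideanSpace ℝ (Fin 3) → EuclideanSpace ℝ (Fin 3)} (hφ : MemLp φ 2 volume) :
    MemLp (fun x => φ (γ⁻¹ • (x - x₀))) 2 volume := by
  have e : (fun x : EuclideanSpace ℝ (Fin 3) => γ⁻¹ • (x - x₀)) =
      fun x => (-(γ⁻¹ • x₀)) + γ⁻¹ • x := by
    funext x
    rw [smul_sub]
    abel
  have hmap : Measure.map (fun x : EuclideanSpace ℝ (Fin 3) => γ⁻¹ • (x - x₀)) volume =
      ENNReal.ofReal ((γ⁻¹) ^ Module.finrank ℝ (EuclideanSpace ℝ (Fin 3)))⁻¹ • volume := by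
    rw [e]
    exact map_space_affine_volume (inv_pos.2 hγ) _
  have h2 : MemLp φ 2 (Measure.map (fun x : EuclideanSpace ℝ (Fin 3) => γ⁻¹ • (x - x₀)) volume) := by
    rw [hmap]
    exact hφ.smul_measure ENNReal.ofReal_ne_top
  have hmeas : AEMeasurable (fun x : EuclideanSpace ℝ (Fin 3) => γ⁻¹ • (x - x₀)) volume :=
    ((measurable_id.sub_const x₀).const_smul γ⁻¹).aemeasurable
  exact h2.comp_of_map hmeas

end ViscosityTools

section Viscosity

set_option maxHeartbeats 400000 in
/-- **Seregin 2019, Prop. 1.4 at viscosity `ν > 0`** (from the unit viscosity fact by the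
Navier–Stokes scaling; the consumption shape of
`seregin2019_localWeakL3_epsRegularity.of_suitableWeakOn` with `1 ↦ ν`). For all `M, N` there is
`ε > 0` (depending on `M`, `N`, `ν`) such that: for every parabolic ball `Q(z₀,R)`, `R > 0`, and
every suitable weak solution `(u,p)` of the unforced Navier–Stokes equations with viscosity `ν`
on `Q(z₀,R)` (`IsSuitableWeakSolutionOn`) with `u ∈ L_{2,∞}(Q(z₀,R))`, `p ∈ L_{3/2}(Q(z₀,R))`,
a weak gradient `G` with `D₀(p,R;z₀) + E(G,R;z₀) ≤ N`, the class bound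
`α³|{x ∈ B(x₀,R) : α < |u(t,x)|}| ≤ M³` for all `α > 0`, `t ∈ ]t₀ − R², t₀[`, and whose slice
`u(t₀)` is the weak left limit of `u(t)` in `L²(B(x₀,R))`: if for some `0 < r ≤ R/2`
`|{x ∈ B(x₀,r) : |u(t₀,x)| > ε/r}| ≤ εr³`, then `u ∈ L_∞(Q(z₀, εr))`.
[cite: Seregin2019, Prop. 1.4 (arXiv:1906.06707 §1 p. 3); CaffarelliKohnNirenberg1982, §2 (scaling)] -/
theorem seregin2019_localWeakL3_epsRegularity.of_suitableWeakOn_viscosity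
    (h : seregin2019_localWeakL3_epsRegularity) {ν : ℝ} (hν : 0 < ν) :
    ∀ M N : ℝ, ∃ ε : ℝ, 0 < ε ∧
    ∀ (z₀ : ℝ × EuclideanSpace ℝ (Fin 3)) (R : ℝ), 0 < R →
    ∀ (u : ℝ → EuclideanSpace ℝ (Fin 3) → EuclideanSpace ℝ (Fin 3))
      (p : ℝ → EuclideanSpace ℝ (Fin 3) → ℝ),
      IsSuitableWeakSolutionOn (parabolicCylinderOpens R z₀) ν 0 u p →
      (∃ C : ℝ≥0, ∀ᵐ t ∂(volume.restrict (Ioo (z₀.1 - R ^ 2) z₀.1)),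
        ∫⁻ x in ball z₀.2 R, ‖u t x‖ₑ ^ 2 ≤ C) →
      MemLp (uncurry p) (3 / 2) (volume.restrict (parabolicCylinder R z₀)) →
      ∀ G : ℝ → EuclideanSpace ℝ (Fin 3) → EuclideanSpace ℝ (Fin 3) →L[ℝ] EuclideanSpace ℝ (Fin 3),
        HasWeakSpatialGradientOn (parabolicCylinderOpens R z₀) u G →
        cknDOsc R z₀ p + cknE R z₀ G ≤ ENNReal.ofReal N →
        (∀ t ∈ Ioo (z₀.1 - R ^ 2) z₀.1, ∀ α : ℝ, 0 < α →
          ENNReal.ofReal (α ^ 3) *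
              volume.restrict (ball z₀.2 R) {x : EuclideanSpace ℝ (Fin 3) | α < ‖u t x‖} ≤
            ENNReal.ofReal (M ^ 3)) →
        (∀ w : EuclideanSpace ℝ (Fin 3) → EuclideanSpace ℝ (Fin 3), MemLp w 2 volume →
          Function.support w ⊆ ball z₀.2 R →
          Tendsto (fun t => ∫ x, ⟪u t x, w x⟫_ℝ) (𝓝[<] z₀.1) (𝓝 (∫ x, ⟪u z₀.1 x, w x⟫_ℝ))) →
        ∀ r : ℝ, 0 < r → r ≤ R / 2 →
          volume.restrict (ball z₀.2 r) {x : EuclideanSpace ℝ (Fin 3) | ε / r < ‖u z₀.1 x‖} ≤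
            ENNReal.ofReal (ε * r ^ 3) →
          eLpNorm (uncurry u) ⊤ (volume.restrict (parabolicCylinder (ε * r) z₀)) < ⊤ := by
  intro M N
  -- the scale factor `θ = min(1, √ν)` and the constants of the unit viscosity instance
  obtain ⟨θ, hθdef⟩ : ∃ θ : ℝ, θ = min 1 (Real.sqrt ν) := ⟨_, rfl⟩
  have hsν : 0 < Real.sqrt ν := Real.sqrt_pos.2 hν
  have hθpos : 0 < θ := by rw [hθdef]; exact lt_min one_pos hsν
  have hθ1 : θ ≤ 1 := by rw [hθdef]; exact min_le_left _ _
  have hθs : θ ≤ Real.sqrt ν := by rw [hθdef]; exact min_le_right _ _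
  have hθ2 : θ ^ 2 ≤ ν := by
    calc θ ^ 2 ≤ Real.sqrt ν ^ 2 := pow_le_pow_left₀ hθpos.le hθs 2
      _ = ν := Real.sq_sqrt hν.le
  obtain ⟨κ, hκdef⟩ : ∃ κ : ℝ, κ = min (ν * Real.sqrt ν) (Real.sqrt ν)⁻¹ := ⟨_, rfl⟩
  have hκpos : 0 < κ := by rw [hκdef]; exact lt_min (mul_pos hν hsν) (inv_pos.2 hsν)
  -- the four inequalities on `κ`
  have hκ : κ ≤ θ ^ 3 ∧ κ * θ ≤ ν ∧ κ ≤ θ ∧ κ * Real.sqrt ν ≤ θ := by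
    rcases le_total ν 1 with hν1 | hν1
    · have hs1 : Real.sqrt ν ≤ 1 := by
        rw [← Real.sqrt_one]; exact Real.sqrt_le_sqrt hν1
      have hθeq : θ = Real.sqrt ν := by rw [hθdef]; exact min_eq_right hs1
      have hκle : κ ≤ ν * Real.sqrt ν := by rw [hκdef]; exact min_le_left _ _
      have hs3 : Real.sqrt ν ^ 3 = ν * Real.sqrt ν := by
        rw [pow_succ, Real.sq_sqrt hν.le]
      have hκ1' : κ ≤ 1 := hκle.trans (by nlinarith [Real.sqrt_nonneg ν, hν.le])
      refine ⟨?_, ?_, ?_, ?_⟩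
      · rw [hθeq, hs3]; exact hκle
      · rw [hθeq]
        calc κ * Real.sqrt ν ≤ (ν * Real.sqrt ν) * Real.sqrt ν := by gcongr
          _ = ν * ν := by rw [mul_assoc, Real.mul_self_sqrt hν.le]
          _ ≤ ν * 1 := by gcongr
          _ = ν := mul_one ν
      · rw [hθeq]
        calc κ ≤ ν * Real.sqrt ν := hκle
          _ ≤ 1 * Real.sqrt ν := by gcongr
          _ = Real.sqrt ν := one_mul _
      · rw [hθeq]
        calc κ * Real.sqrt ν ≤ 1 * Real.sqrt ν := by gcongr
          _ = Real.sqrt ν := one_mul _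
    · have hs1 : 1 ≤ Real.sqrt ν := by
        have := Real.sqrt_le_sqrt hν1
        rwa [Real.sqrt_one] at this
      have hθeq : θ = 1 := by rw [hθdef]; exact min_eq_left hs1
      have hκle : κ ≤ (Real.sqrt ν)⁻¹ := by rw [hκdef]; exact min_le_right _ _
      have hinv1 : (Real.sqrt ν)⁻¹ ≤ 1 := inv_le_one_of_one_le₀ hs1
      refine ⟨?_, ?_, ?_, ?_⟩
      · rw [hθeq, one_pow]; exact hκle.trans hinv1
      · rw [hθeq, mul_one]; exact (hκle.trans hinv1).trans hν1
      · rw [hθeq]; exact hκle.trans hinv1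
      · rw [hθeq]
        calc κ * Real.sqrt ν ≤ (Real.sqrt ν)⁻¹ * Real.sqrt ν := by gcongr
          _ = 1 := inv_mul_cancel₀ hsν.ne'
  obtain ⟨hκ1, hκ2, hκ3, hκ4⟩ := hκ
  -- the unit viscosity instance
  obtain ⟨ε', hε', -, hunit⟩ :=
    h.unit (M / ν) ((4 * (ν * θ)⁻¹ ^ 2 + (ν * θ)⁻¹) * max N 0)
  refine ⟨ε' * κ, mul_pos hε' hκpos, ?_⟩
  intro z₀ R hR u p hsw hC hp G hG hN hM hw r hr hrR hdens
  -- the zoom `Φ(s, y) = (t₀ + βs, x₀ + R'y)`, `R' = θR`, `β = R'²/ν`, and the weight `α = R'/ν`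
  obtain ⟨R', hR'def⟩ : ∃ R' : ℝ, R' = θ * R := ⟨_, rfl⟩
  have hR' : 0 < R' := by rw [hR'def]; exact mul_pos hθpos hR
  have hR'R : R' ≤ R := by rw [hR'def]; exact mul_le_of_le_one_left hR.le hθ1
  obtain ⟨β, hβdef⟩ : ∃ β : ℝ, β = R' ^ 2 / ν := ⟨_, rfl⟩
  have hβ : 0 < β := by rw [hβdef]; positivity
  have hβR : β ≤ R ^ 2 := by
    rw [hβdef, div_le_iff₀ hν, hR'def, mul_pow]
    calc θ ^ 2 * R ^ 2 ≤ ν * R ^ 2 := by gcongr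
      _ = R ^ 2 * ν := mul_comm _ _
  obtain ⟨α, hαdef⟩ : ∃ α : ℝ, α = R' / ν := ⟨_, rfl⟩
  have hα : 0 < α := by rw [hαdef]; positivity
  have hβeq : β = α * R' := by rw [hβdef, hαdef]; ring
  -- the `ν`-cylinder `PO = ]t₀ − β, t₀[ × B(x₀, R')` inside `Q(z₀, R)` and its preimage `Q(0, 1)`
  set POs : Set (ℝ × EuclideanSpace ℝ (Fin 3)) := Ioo (z₀.1 - β) z₀.1 ×ˢ ball z₀.2 R'
    with hPOs
  have hPOsub : POs ⊆ parabolicCylinder R z₀ := by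
    rw [hPOs, parabolicCylinder]
    exact prod_mono (Ioo_subset_Ioo (by linarith) le_rfl) (ball_subset_ball hR'R)
  set PO : TopologicalSpace.Opens (ℝ × EuclideanSpace ℝ (Fin 3)) :=
    ⟨POs, isOpen_Ioo.prod isOpen_ball⟩ with hPO
  have hPOle : PO ≤ parabolicCylinderOpens R z₀ := fun z hz => hPOsub hz
  have hpre1' : stAffine β R' z₀.1 z₀.2 ⁻¹' POs =
      parabolicCylinder 1 (0 : ℝ × EuclideanSpace ℝ (Fin 3)) := by
    have h1 := stAffine_preimage_cylinder_eq_parabolicCylinder hν hR' z₀.1 z₀.2 R'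
    rw [div_self hR'.ne', ← hβdef] at h1
    exact h1
  have hpre1 : stPreimage β R' z₀.1 z₀.2 PO =
      parabolicCylinderOpens 1 (0 : ℝ × EuclideanSpace ℝ (Fin 3)) := by
    apply TopologicalSpace.Opens.ext
    rw [coe_stPreimage]
    exact hpre1'
  -- the rescaled pair and gradient
  set v : ℝ → EuclideanSpace ℝ (Fin 3) → EuclideanSpace ℝ (Fin 3) := α • stPull β R' z₀.1 z₀.2 u
    with hv
  set q : ℝ → EuclideanSpace ℝ (Fin 3) → ℝ := α ^ 2 • stPull β R' z₀.1 z₀.2 p with hq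
  set G' : ℝ → EuclideanSpace ℝ (Fin 3) → EuclideanSpace ℝ (Fin 3) →L[ℝ] EuclideanSpace ℝ (Fin 3) :=
    (α * R') • stPull β R' z₀.1 z₀.2 G with hG'
  -- (1) suitable weak at unit viscosity on `Q(0, 1)`
  have hsuit1 : IsSuitableWeakSolutionOn (parabolicCylinderOpens 1 (0 : ℝ × EuclideanSpace ℝ (Fin 3)))
      1 0 v q := by
    have h0 := (hsw.of_le hPOle).stRescale hα hR' hβeq z₀.1 z₀.2
    have hvisc : α * ν / R' = 1 := by
      rw [hαdef]; field_simp
    have hforce : ((α ^ 2 * R') • stPull β R' z₀.1 z₀.2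
        (0 : ℝ → EuclideanSpace ℝ (Fin 3) → EuclideanSpace ℝ (Fin 3))) = 0 := by
      funext s y; simp [stPull]
    rw [hvisc, hforce, hpre1] at h0
    exact h0
  -- (2) the energy class on `Q(0, 1)`
  have hC1 : ∃ C₁ : ℝ≥0, ∀ᵐ s ∂(volume.restrict (Ioo ((0 : ℝ × EuclideanSpace ℝ (Fin 3)).1 - 1 ^ 2)
      (0 : ℝ × EuclideanSpace ℝ (Fin 3)).1)),
      ∫⁻ y in ball (0 : ℝ × EuclideanSpace ℝ (Fin 3)).2 1, ‖v s y‖ₑ ^ 2 ≤ C₁ := by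
    obtain ⟨C, hC⟩ := hC
    have hC0 : ∀ᵐ t ∂(volume.restrict (Ioo (z₀.1 + β * (-1)) (z₀.1 + β * 0))),
        ∫⁻ x in ball z₀.2 R', ‖u t x‖ₑ ^ 2 ≤ (C : ℝ≥0∞) := by
      have e : Ioo (z₀.1 + β * (-1)) (z₀.1 + β * 0) = Ioo (z₀.1 - β) z₀.1 := by
        congr 1 <;> ring
      rw [e]
      have hsubI : Ioo (z₀.1 - β) z₀.1 ⊆ Ioo (z₀.1 - R ^ 2) z₀.1 :=
        Ioo_subset_Ioo (by linarith) le_rfl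
      filter_upwards [ae_restrict_of_ae_restrict_of_subset hsubI hC] with t ht
      exact (lintegral_mono_set (ball_subset_ball hR'R)).trans ht
    have h2 := ae_sliced_setLIntegral_ball_stRescale hβ hR' z₀.1 z₀.2 z₀.2 R' (-1) 0
      (fun t x => ‖u t x‖ₑ ^ 2) hC0
    rw [finrank_euclideanSpace_fin, sub_self, smul_zero, div_self hR'.ne'] at h2
    set C₁ : ℝ≥0∞ := ‖α‖ₑ ^ 2 * (ENNReal.ofReal (R' ^ 3)⁻¹ * C) with hC₁
    have hC₁top : C₁ ≠ ⊤ :=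
      ENNReal.mul_ne_top (by simp) (ENNReal.mul_ne_top ENNReal.ofReal_ne_top ENNReal.coe_ne_top)
    refine ⟨C₁.toNNReal, ?_⟩
    rw [ENNReal.coe_toNNReal hC₁top]
    have hset : Ioo ((0 : ℝ × EuclideanSpace ℝ (Fin 3)).1 - 1 ^ 2)
        (0 : ℝ × EuclideanSpace ℝ (Fin 3)).1 = Ioo (-1 : ℝ) 0 := by simp
    rw [hset]
    filter_upwards [h2] with s hs
    have e : ∀ y : EuclideanSpace ℝ (Fin 3), ‖v s y‖ₑ ^ 2 =
        ‖α‖ₑ ^ 2 * ‖u (z₀.1 + β * s) (z₀.2 + R' • y)‖ₑ ^ 2 := by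
      intro y
      rw [hv, smul_stPull_apply, enorm_smul, mul_pow]
    simp only [e]
    rw [lintegral_const_mul' _ _ (by simp)]
    refine mul_le_mul' le_rfl ?_
    have e0 : (0 : ℝ × EuclideanSpace ℝ (Fin 3)).2 = 0 := rfl
    rw [e0]
    exact hs
  -- (3) the weak gradient on `Q(0, 1)` and its square integrability
  have hGv : HasWeakSpatialGradientOn (parabolicCylinderOpens 1 (0 : ℝ × EuclideanSpace ℝ (Fin 3)))
      v G' := by
    rw [← hpre1]
    exact (hG.mono hPOle).stRescale α hβ hR' z₀.1 z₀.2
  have hE_le : cknE R z₀ G ≤ ENNReal.ofReal (max N 0) :=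
    le_add_self.trans (hN.trans (ENNReal.ofReal_le_ofReal (le_max_left _ _)))
  have hD_le : cknDOsc R z₀ p ≤ ENNReal.ofReal (max N 0) :=
    le_self_add.trans (hN.trans (ENNReal.ofReal_le_ofReal (le_max_left _ _)))
  have hEfin : ∫⁻ w in parabolicCylinder R z₀, ENNReal.ofReal (frobeniusNormSq (G w.1 w.2)) < ⊤ := by
    have hE : cknE R z₀ G < ⊤ := hE_le.trans_lt ENNReal.ofReal_lt_top
    have hR0 : (ENNReal.ofReal R)⁻¹ ≠ 0 := ENNReal.inv_ne_zero.2 ENNReal.ofReal_ne_top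
    unfold cknE at hE
    rcases ENNReal.mul_lt_top_iff.1 hE with h2 | h0 | h0
    · exact h2.2
    · exact absurd h0 hR0
    · rw [h0]; exact ENNReal.zero_lt_top
  have hGv2 : ∫⁻ w in parabolicCylinder 1 (0 : ℝ × EuclideanSpace ℝ (Fin 3)),
      ENNReal.ofReal (frobeniusNormSq (G' w.1 w.2)) < ⊤ := by
    rw [← hpre1', hG', setLIntegral_frobeniusNormSq_stRescale hβ hR' z₀.1 z₀.2 (α * R') G POs]
    exact ENNReal.mul_lt_top (ENNReal.mul_lt_top ENNReal.ofReal_lt_top ENNReal.ofReal_lt_top)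
      ((lintegral_mono_set hPOsub).trans_lt hEfin)
  -- (4) the pressure class on `Q(0, 1)`
  have h32 : ((3 : ℝ≥0∞) / 2).toReal = 3 / 2 := by
    rw [ENNReal.toReal_div]; norm_num
  have h32top : (3 : ℝ≥0∞) / 2 ≠ ⊤ := (ENNReal.div_lt_top (by simp) (by simp)).ne
  have hpfin : ∫⁻ w in parabolicCylinder R z₀, ‖p w.1 w.2‖ₑ ^ (3 / 2 : ℝ) < ⊤ := by
    have hp' := hp.eLpNorm_lt_top
    rw [eLpNorm_eq_lintegral_rpow_enorm_toReal (by norm_num) h32top, h32] at hp'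
    exact (ENNReal.rpow_lt_top_iff_of_pos (by norm_num : (0 : ℝ) < 1 / (3 / 2))).1 hp'
  have hq32 : MemLp (uncurry q) (3 / 2)
      (volume.restrict (parabolicCylinder 1 (0 : ℝ × EuclideanSpace ℝ (Fin 3)))) := by
    refine ⟨hsuit1.distributional.2.2.1.aestronglyMeasurable, ?_⟩
    rw [eLpNorm_eq_lintegral_rpow_enorm_toReal (by norm_num) h32top, h32]
    refine ENNReal.rpow_lt_top_of_nonneg (by positivity) (ne_of_lt ?_)
    show ∫⁻ w in parabolicCylinder 1 (0 : ℝ × EuclideanSpace ℝ (Fin 3)),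
        ‖(α ^ 2 • stPull β R' z₀.1 z₀.2 p) w.1 w.2‖ₑ ^ (3 / 2 : ℝ) < ⊤
    rw [← hpre1', setLIntegral_enorm_rpow_stRescale hβ hR' z₀.1 z₀.2 (α ^ 2) p POs (by norm_num)]
    refine ENNReal.mul_lt_top (ENNReal.mul_lt_top
      (ENNReal.rpow_lt_top_of_nonneg (by norm_num) enorm_ne_top) ENNReal.ofReal_lt_top) ?_
    exact (lintegral_mono_set hPOsub).trans_lt hpfin
  have hball : IsSuitableWeakSolutionInBall 1 0 v q := ⟨hsuit1, hC1, ⟨G', hGv, hGv2⟩, hq32⟩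
  -- (5) `E ≤ (νθ)⁻¹ N` on `Q(0, 1)`
  have hcknE_eq : ∫⁻ w in parabolicCylinder R z₀, ENNReal.ofReal (frobeniusNormSq (G w.1 w.2)) =
      ENNReal.ofReal R * cknE R z₀ G := by
    unfold cknE
    rw [← mul_assoc, ENNReal.mul_inv_cancel ((ENNReal.ofReal_pos.2 hR).ne') ENNReal.ofReal_ne_top,
      one_mul]
  have hE' : cknE 1 (0 : ℝ × EuclideanSpace ℝ (Fin 3)) G' ≤
      ENNReal.ofReal ((ν * θ)⁻¹) * ENNReal.ofReal (max N 0) := by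
    unfold cknE
    rw [ENNReal.ofReal_one, inv_one, one_mul, ← hpre1', hG',
      setLIntegral_frobeniusNormSq_stRescale hβ hR' z₀.1 z₀.2 (α * R') G POs,
      finrank_euclideanSpace_fin]
    have hc : ENNReal.ofReal ((α * R') ^ 2) * ENNReal.ofReal (β * R' ^ 3)⁻¹ * ENNReal.ofReal R =
        ENNReal.ofReal ((ν * θ)⁻¹) := by
      rw [← ENNReal.ofReal_mul (by positivity), ← ENNReal.ofReal_mul (by positivity)]
      congr 1
      rw [hβdef, hαdef, hR'def]
      field_simp
    calc ENNReal.ofReal ((α * R') ^ 2) * ENNReal.ofReal (β * R' ^ 3)⁻¹ *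
          ∫⁻ w in POs, ENNReal.ofReal (frobeniusNormSq (G w.1 w.2))
        ≤ ENNReal.ofReal ((α * R') ^ 2) * ENNReal.ofReal (β * R' ^ 3)⁻¹ *
          ∫⁻ w in parabolicCylinder R z₀, ENNReal.ofReal (frobeniusNormSq (G w.1 w.2)) := by
          gcongr
      _ = ENNReal.ofReal ((α * R') ^ 2) * ENNReal.ofReal (β * R' ^ 3)⁻¹ * ENNReal.ofReal R *
          cknE R z₀ G := by rw [hcknE_eq]; ring
      _ = ENNReal.ofReal ((ν * θ)⁻¹) * cknE R z₀ G := by rw [hc]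
      _ ≤ ENNReal.ofReal ((ν * θ)⁻¹) * ENNReal.ofReal (max N 0) := by gcongr
  -- (6) `D₀ ≤ 4(νθ)⁻² N` on `Q(0, 1)`, with the ball mean over `B(x₀, R)` as a gauge
  haveI hfinQ : IsFiniteMeasure (volume.restrict (parabolicCylinder R z₀)) := by
    refine isFiniteMeasure_restrict.2 (ne_of_lt ?_)
    rw [parabolicCylinder, Measure.volume_eq_prod, Measure.prod_prod]
    exact ENNReal.mul_lt_top measure_Ioo_lt_top measure_ball_lt_top
  have h1le32 : (1 : ℝ≥0∞) ≤ 3 / 2 := by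
    rw [ENNReal.le_div_iff_mul_le (Or.inl (by norm_num)) (Or.inl (by norm_num))]
    norm_num
  have hpint : IntegrableOn (uncurry p) (parabolicCylinder R z₀) volume :=
    hp.integrable h1le32
  have hqint : IntegrableOn (uncurry q) (parabolicCylinder 1 (0 : ℝ × EuclideanSpace ℝ (Fin 3)))
      volume := by
    have h1 := (integrableOn_comp_stAffine_iff hβ hR' z₀.1 z₀.2 (uncurry p) POs).2
      (hpint.mono_set hPOsub)
    rw [hpre1'] at h1
    have e : uncurry q = fun w => (α ^ 2) • (uncurry p ∘ stAffine β R' z₀.1 z₀.2) w := by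
      funext w; rfl
    rw [e]
    exact h1.smul (α ^ 2)
  -- the gauge and the gauged pressure
  set pt : ℝ → EuclideanSpace ℝ (Fin 3) → ℝ := fun t x => p t x - ⨍ y in ball z₀.2 R, p t y with hpt
  set c' : ℝ → ℝ := fun s => α ^ 2 * ⨍ y in ball z₀.2 R, p (z₀.1 + β * s) y with hc'
  have hid : (fun s y => q s y - c' s) = α ^ 2 • stPull β R' z₀.1 z₀.2 pt := by
    funext s y
    rw [hq, smul_stPull_apply, smul_stPull_apply, hpt, hc']
    simp only [smul_eq_mul]
    ring
  have hptm : AEStronglyMeasurable (uncurry pt) (volume.restrict POs) := by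
    have hpm : AEStronglyMeasurable (uncurry p) (volume.restrict (parabolicCylinder R z₀)) := hp.1
    have hmean : AEStronglyMeasurable
        (fun w : ℝ × EuclideanSpace ℝ (Fin 3) => ⨍ y in ball z₀.2 R, p w.1 y)
        (volume.restrict (parabolicCylinder R z₀)) :=
      aestronglyMeasurable_setAverage_slice hpm
    have h1 : AEStronglyMeasurable (uncurry pt) (volume.restrict (parabolicCylinder R z₀)) :=
      (hpm.sub hmean).congr (Filter.Eventually.of_forall fun w => rfl)
    exact h1.mono_measure (Measure.restrict_mono hPOsub le_rfl)
  have hmeas : AEStronglyMeasurable (uncurry fun s y => q s y - c' s)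
      (volume.restrict (parabolicCylinder 1 (0 : ℝ × EuclideanSpace ℝ (Fin 3)))) := by
    rw [hid, ← hpre1']
    have hmap := map_stAffine_volume_restrict_preimage (E := EuclideanSpace ℝ (Fin 3)) hβ hR'
      z₀.1 z₀.2 POs
    have h1 : AEStronglyMeasurable (uncurry pt)
        (Measure.map (stAffine β R' z₀.1 z₀.2)
          (volume.restrict (stAffine β R' z₀.1 z₀.2 ⁻¹' POs))) := by
      rw [hmap]; exact hptm.smul_measure _
    have h2 := h1.comp_measurable (measurable_stAffine _ _ _ _)
    have h3 : uncurry (α ^ 2 • stPull β R' z₀.1 z₀.2 pt) =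
        fun w => (α ^ 2) • (uncurry pt ∘ stAffine β R' z₀.1 z₀.2) w := by
      funext w; rfl
    rw [h3]
    exact h2.const_smul (α ^ 2)
  have hcknD_eq : ∫⁻ w in parabolicCylinder R z₀, ‖pt w.1 w.2‖ₑ ^ (3 / 2 : ℝ) =
      ENNReal.ofReal R ^ 2 * cknDOsc R z₀ p := by
    unfold cknDOsc
    rw [← mul_assoc, ENNReal.mul_inv_cancel (pow_ne_zero _ (ENNReal.ofReal_pos.2 hR).ne')
      (ENNReal.pow_ne_top ENNReal.ofReal_ne_top), one_mul]
  have hα32 : ‖α ^ 2‖ₑ ^ (3 / 2 : ℝ) = ENNReal.ofReal (α ^ 3) := by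
    rw [Real.enorm_eq_ofReal (sq_nonneg α), ENNReal.ofReal_rpow_of_nonneg (sq_nonneg α) (by norm_num)]
    congr 1
    rw [show (α ^ 2 : ℝ) = α ^ (2 : ℝ) by norm_cast, ← Real.rpow_mul hα.le,
      show (2 : ℝ) * (3 / 2) = (3 : ℕ) by norm_num, Real.rpow_natCast]
  have hD' : cknDOsc 1 (0 : ℝ × EuclideanSpace ℝ (Fin 3)) q ≤
      ENNReal.ofReal (4 * (ν * θ)⁻¹ ^ 2) * ENNReal.ofReal (max N 0) := by
    have hc : (4 : ℝ≥0∞) * (ENNReal.ofReal (α ^ 3) * ENNReal.ofReal (β * R' ^ 3)⁻¹ *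
        ENNReal.ofReal R ^ 2) = ENNReal.ofReal (4 * (ν * θ)⁻¹ ^ 2) := by
      rw [← ENNReal.ofReal_pow hR.le, ← ENNReal.ofReal_mul (by positivity),
        ← ENNReal.ofReal_mul (by positivity), ← ENNReal.ofReal_ofNat,
        ← ENNReal.ofReal_mul (by norm_num)]
      congr 1
      rw [hβdef, hαdef, hR'def]
      field_simp
    calc cknDOsc 1 (0 : ℝ × EuclideanSpace ℝ (Fin 3)) q
        = cknDOsc 1 (0 : ℝ × EuclideanSpace ℝ (Fin 3)) (fun s y => q s y - c' s) :=
          (cknDOsc_sub_fun_time_of_integrableOn one_pos c' hqint).symm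
      _ ≤ 4 * cknD 1 (0 : ℝ × EuclideanSpace ℝ (Fin 3)) (fun s y => q s y - c' s) :=
          AlbrittonBarker2019.cknDOsc_le_four_mul_cknD one_pos hmeas
      _ = 4 * cknD 1 (0 : ℝ × EuclideanSpace ℝ (Fin 3)) (α ^ 2 • stPull β R' z₀.1 z₀.2 pt) := by
          rw [hid]
      _ = 4 * ∫⁻ w in stAffine β R' z₀.1 z₀.2 ⁻¹' POs,
            ‖(α ^ 2 • stPull β R' z₀.1 z₀.2 pt) w.1 w.2‖ₑ ^ (3 / 2 : ℝ) := by
          rw [cknD, ← hpre1', ENNReal.ofReal_one, one_pow, inv_one, one_mul]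
      _ = 4 * (‖α ^ 2‖ₑ ^ (3 / 2 : ℝ) * ENNReal.ofReal (β * R' ^ 3)⁻¹ *
            ∫⁻ w in POs, ‖pt w.1 w.2‖ₑ ^ (3 / 2 : ℝ)) := by
          rw [setLIntegral_enorm_rpow_stRescale hβ hR' z₀.1 z₀.2 (α ^ 2) pt POs (by norm_num),
            finrank_euclideanSpace_fin]
      _ ≤ 4 * (‖α ^ 2‖ₑ ^ (3 / 2 : ℝ) * ENNReal.ofReal (β * R' ^ 3)⁻¹ *
            ∫⁻ w in parabolicCylinder R z₀, ‖pt w.1 w.2‖ₑ ^ (3 / 2 : ℝ)) := by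
          gcongr
      _ = 4 * (ENNReal.ofReal (α ^ 3) * ENNReal.ofReal (β * R' ^ 3)⁻¹ * ENNReal.ofReal R ^ 2) *
            cknDOsc R z₀ p := by rw [hcknD_eq, hα32]; ring
      _ = ENNReal.ofReal (4 * (ν * θ)⁻¹ ^ 2) * cknDOsc R z₀ p := by rw [hc]
      _ ≤ ENNReal.ofReal (4 * (ν * θ)⁻¹ ^ 2) * ENNReal.ofReal (max N 0) := by gcongr
  have hN' : cknDOsc 1 (0 : ℝ × EuclideanSpace ℝ (Fin 3)) q +
      cknE 1 (0 : ℝ × EuclideanSpace ℝ (Fin 3)) G' ≤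
      ENNReal.ofReal ((4 * (ν * θ)⁻¹ ^ 2 + (ν * θ)⁻¹) * max N 0) := by
    refine (add_le_add hD' hE').trans_eq ?_
    rw [← ENNReal.ofReal_mul (by positivity), ← ENNReal.ofReal_mul (by positivity),
      ← ENNReal.ofReal_add (by positivity) (by positivity)]
    congr 1
    ring
  -- (7) the weak-`L³` class of `v` on `Q(0, 1)` with constant `M/ν`
  have hM' : ∀ s ∈ Ioo (-1 : ℝ) 0, ∀ a : ℝ, 0 < a →
      ENNReal.ofReal (a ^ 3) *
          (volume.restrict (ball (0 : EuclideanSpace ℝ (Fin 3)) 1))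
            {y : EuclideanSpace ℝ (Fin 3) | a < ‖v s y‖} ≤
        ENNReal.ofReal ((M / ν) ^ 3) := by
    intro s hs a ha
    have ht : z₀.1 + β * s ∈ Ioo (z₀.1 - R ^ 2) z₀.1 :=
      ⟨by nlinarith [hs.1], by nlinarith [hs.2]⟩
    have hset : (volume.restrict (ball (0 : EuclideanSpace ℝ (Fin 3)) 1))
          {y : EuclideanSpace ℝ (Fin 3) | a < ‖v s y‖} =
        ENNReal.ofReal (R' ^ 3)⁻¹ *
          (volume.restrict (ball z₀.2 (R' * 1)))
            {x : EuclideanSpace ℝ (Fin 3) | a / α < ‖u (z₀.1 + β * s) x‖} :=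
      restrict_ball_superlevel_dilate hα hR' z₀.2 (u (z₀.1 + β * s)) a 1
    rw [mul_one] at hset
    have hmono : (volume.restrict (ball z₀.2 R'))
          {x : EuclideanSpace ℝ (Fin 3) | a / α < ‖u (z₀.1 + β * s) x‖} ≤
        (volume.restrict (ball z₀.2 R))
          {x : EuclideanSpace ℝ (Fin 3) | a / α < ‖u (z₀.1 + β * s) x‖} :=
      Measure.le_iff'.1 (Measure.restrict_mono (ball_subset_ball hR'R) le_rfl) _
    have hyp := hM (z₀.1 + β * s) ht (a / α) (div_pos ha hα)
    have ha3 : a ^ 3 = α ^ 3 * (a / α) ^ 3 := by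
      field_simp
    rw [hset, ha3, ENNReal.ofReal_mul (by positivity)]
    calc ENNReal.ofReal (α ^ 3) * ENNReal.ofReal ((a / α) ^ 3) * (ENNReal.ofReal (R' ^ 3)⁻¹ *
          (volume.restrict (ball z₀.2 R'))
            {x : EuclideanSpace ℝ (Fin 3) | a / α < ‖u (z₀.1 + β * s) x‖})
        = ENNReal.ofReal (α ^ 3) * ENNReal.ofReal (R' ^ 3)⁻¹ * (ENNReal.ofReal ((a / α) ^ 3) *
          (volume.restrict (ball z₀.2 R'))
            {x : EuclideanSpace ℝ (Fin 3) | a / α < ‖u (z₀.1 + β * s) x‖}) := by ring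
      _ ≤ ENNReal.ofReal (α ^ 3) * ENNReal.ofReal (R' ^ 3)⁻¹ * (ENNReal.ofReal ((a / α) ^ 3) *
          (volume.restrict (ball z₀.2 R))
            {x : EuclideanSpace ℝ (Fin 3) | a / α < ‖u (z₀.1 + β * s) x‖}) := by gcongr
      _ ≤ ENNReal.ofReal (α ^ 3) * ENNReal.ofReal (R' ^ 3)⁻¹ * ENNReal.ofReal (M ^ 3) := by
          gcongr
      _ = ENNReal.ofReal ((M / ν) ^ 3) := by
          rw [← ENNReal.ofReal_mul (by positivity), ← ENNReal.ofReal_mul (by positivity)]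
          congr 1
          rw [hαdef]
          field_simp
  -- (8) weak left-continuity of `v` at `s = 0` in `L²(B(0, 1))`
  have hw' : ∀ φ : EuclideanSpace ℝ (Fin 3) → EuclideanSpace ℝ (Fin 3), MemLp φ 2 volume →
      Function.support φ ⊆ ball (0 : EuclideanSpace ℝ (Fin 3)) 1 →
      Tendsto (fun s => ∫ y, ⟪v s y, φ y⟫) (𝓝[<] (0 : ℝ)) (𝓝 (∫ y, ⟪v 0 y, φ y⟫)) := by
    intro φ hφ hφs
    set w : EuclideanSpace ℝ (Fin 3) → EuclideanSpace ℝ (Fin 3) :=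
      fun x => φ (R'⁻¹ • (x - z₀.2)) with hwdef
    have hwL2 : MemLp w 2 volume := memLp_two_comp_dilate_symm hR' z₀.2 hφ
    have hws : Function.support w ⊆ ball z₀.2 R := by
      intro x hx
      have hx' : R'⁻¹ • (x - z₀.2) ∈ ball (0 : EuclideanSpace ℝ (Fin 3)) 1 := hφs hx
      rw [mem_ball, dist_zero_right, norm_smul, Real.norm_eq_abs, abs_of_pos (inv_pos.2 hR'),
        inv_mul_lt_iff₀ hR', mul_one] at hx'
      rw [mem_ball, dist_eq_norm]
      exact lt_of_lt_of_le hx' hR'R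
    have key : ∀ s : ℝ, ∫ y, ⟪v s y, φ y⟫ =
        α * (R' ^ 3)⁻¹ * ∫ x, ⟪u (z₀.1 + β * s) x, w x⟫ := by
      intro s
      have e : (fun y => ⟪v s y, φ y⟫) =
          fun y => ⟪α • u (z₀.1 + β * s) (z₀.2 + R' • y), φ y⟫ := by
        funext y; rw [hv, smul_stPull_apply]
      rw [e]
      exact integral_inner_dilate hR' α z₀.2 (u (z₀.1 + β * s)) φ
    have hlim := hw w hwL2 hws
    have hg : Tendsto (fun s : ℝ => z₀.1 + β * s) (𝓝[<] (0 : ℝ)) (𝓝[<] z₀.1) := by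
      have hc : ContinuousWithinAt (fun s : ℝ => z₀.1 + β * s) (Iio 0) 0 :=
        (by fun_prop : Continuous fun s : ℝ => z₀.1 + β * s).continuousWithinAt
      have hmaps : MapsTo (fun s : ℝ => z₀.1 + β * s) (Iio 0) (Iio z₀.1) := by
        intro s hs
        simp only [mem_Iio] at hs ⊢
        nlinarith
      have := hc.tendsto_nhdsWithin hmaps
      rwa [mul_zero, add_zero] at this
    have hcomp := (hlim.comp hg).const_mul (α * (R' ^ 3)⁻¹)
    rw [show (fun s => ∫ y, ⟪v s y, φ y⟫) =
      fun s => α * (R' ^ 3)⁻¹ * ∫ x, ⟪u (z₀.1 + β * s) x, w x⟫ from funext key, key 0,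
      mul_zero, add_zero]
    exact hcomp
  -- (9) the density hypothesis at radius `r/R`
  have hr' : 0 < r / R := div_pos hr hR
  have hr'2 : r / R ≤ 1 / 2 := by
    rw [div_le_iff₀ hR]; linarith
  have hdens' : (volume.restrict (ball (0 : EuclideanSpace ℝ (Fin 3)) (r / R)))
        {y : EuclideanSpace ℝ (Fin 3) | ε' / (r / R) < ‖v 0 y‖} ≤
      ENNReal.ofReal (ε' * (r / R) ^ 3) := by
    have hset : (volume.restrict (ball (0 : EuclideanSpace ℝ (Fin 3)) (r / R)))
          {y : EuclideanSpace ℝ (Fin 3) | ε' / (r / R) < ‖v 0 y‖} =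
        ENNReal.ofReal (R' ^ 3)⁻¹ *
          (volume.restrict (ball z₀.2 (R' * (r / R))))
            {x : EuclideanSpace ℝ (Fin 3) | ε' / (r / R) / α < ‖u (z₀.1 + β * 0) x‖} :=
      restrict_ball_superlevel_dilate hα hR' z₀.2 (u (z₀.1 + β * 0)) (ε' / (r / R)) (r / R)
    rw [mul_zero, add_zero] at hset
    have hrad : R' * (r / R) = θ * r := by
      rw [hR'def]; field_simp
    have hthr : ε' * κ / r ≤ ε' / (r / R) / α := by
      rw [hαdef, hR'def, div_div, div_le_div_iff₀ hr (by positivity)]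
      -- `ε' κ (r/R · θR/ν) ≤ ε' r`, i.e. `κ θ ≤ ν`
      have : ε' * κ * (r / R * (θ * R / ν)) = ε' * r * (κ * θ / ν) := by
        field_simp
      rw [this]
      calc ε' * r * (κ * θ / ν) ≤ ε' * r * 1 :=
            mul_le_mul_of_nonneg_left ((div_le_one hν).2 hκ2) (by positivity)
        _ = ε' * r := mul_one _
    have hincl : {x : EuclideanSpace ℝ (Fin 3) | ε' / (r / R) / α < ‖u z₀.1 x‖} ∩ ball z₀.2 (θ * r) ⊆
        {x : EuclideanSpace ℝ (Fin 3) | ε' * κ / r < ‖u z₀.1 x‖} ∩ ball z₀.2 r := by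
      rintro x ⟨hx1, hx2⟩
      refine ⟨lt_of_le_of_lt hthr hx1, ball_subset_ball ?_ hx2⟩
      exact mul_le_of_le_one_left hr.le hθ1
    have hmeasure : (volume.restrict (ball z₀.2 (θ * r)))
          {x : EuclideanSpace ℝ (Fin 3) | ε' / (r / R) / α < ‖u z₀.1 x‖} ≤
        ENNReal.ofReal (ε' * κ * r ^ 3) := by
      rw [Measure.restrict_apply' measurableSet_ball]
      refine (measure_mono hincl).trans ?_
      rw [← Measure.restrict_apply' measurableSet_ball]
      exact hdens
    rw [hset, hrad]
    calc ENNReal.ofReal (R' ^ 3)⁻¹ * (volume.restrict (ball z₀.2 (θ * r)))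
          {x : EuclideanSpace ℝ (Fin 3) | ε' / (r / R) / α < ‖u z₀.1 x‖}
        ≤ ENNReal.ofReal (R' ^ 3)⁻¹ * ENNReal.ofReal (ε' * κ * r ^ 3) := by gcongr
      _ = ENNReal.ofReal ((R' ^ 3)⁻¹ * (ε' * κ * r ^ 3)) := by
          rw [← ENNReal.ofReal_mul (by positivity)]
      _ ≤ ENNReal.ofReal (ε' * (r / R) ^ 3) := by
          apply ENNReal.ofReal_le_ofReal
          rw [hR'def]
          have e : (θ * R) ^ 3 = θ ^ 3 * R ^ 3 := mul_pow θ R 3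
          rw [e, div_pow]
          have : (θ ^ 3 * R ^ 3)⁻¹ * (ε' * κ * r ^ 3) = (ε' * (r ^ 3 / R ^ 3)) * (κ / θ ^ 3) := by
            field_simp
          rw [this]
          calc ε' * (r ^ 3 / R ^ 3) * (κ / θ ^ 3) ≤ ε' * (r ^ 3 / R ^ 3) * 1 :=
                mul_le_mul_of_nonneg_left ((div_le_one (by positivity)).2 hκ1) (by positivity)
            _ = ε' * (r ^ 3 / R ^ 3) := mul_one _
  -- (10) the unit viscosity fact on `Q(0, 1)`
  have hconc := hunit v q hball G' hGv hN' hM' hw' (r / R) hr' hr'2 hdens'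
  -- (11) back to `u`: `Q(0, ε' r/R) = Φ⁻¹(]t₀ − β(ε'r/R)², t₀[ × B(x₀, R'ε'r/R)) ⊇ Φ⁻¹(Q(z₀, ε'κr))`
  set ρ' : ℝ := ε' * (r / R) with hρ'
  have hρ'pos : 0 < ρ' := mul_pos hε' hr'
  have hpreS : stAffine β R' z₀.1 z₀.2 ⁻¹' (Ioo (z₀.1 - β * ρ' ^ 2) z₀.1 ×ˢ ball z₀.2 (R' * ρ')) =
      parabolicCylinder ρ' (0 : ℝ × EuclideanSpace ℝ (Fin 3)) := by
    have e1 : (z₀.1 - β * ρ' ^ 2 - z₀.1) / β = (0 : ℝ × EuclideanSpace ℝ (Fin 3)).1 - ρ' ^ 2 := by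
      have : z₀.1 - β * ρ' ^ 2 - z₀.1 = β * (-(ρ' ^ 2)) := by ring
      rw [this, mul_div_cancel_left₀ _ hβ.ne', Prod.fst_zero, zero_sub]
    have e2 : (z₀.1 - z₀.1) / β = (0 : ℝ × EuclideanSpace ℝ (Fin 3)).1 := by
      rw [sub_self, zero_div, Prod.fst_zero]
    have e3 : R'⁻¹ • (z₀.2 - z₀.2) = (0 : ℝ × EuclideanSpace ℝ (Fin 3)).2 := by
      rw [sub_self, smul_zero, Prod.snd_zero]
    have e4 : R' * ρ' / R' = ρ' := mul_div_cancel_left₀ ρ' hR'.ne'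
    rw [stAffine_preimage_cylinder hβ hR' z₀.1 z₀.2 z₀.2, e1, e2, e3, e4, parabolicCylinder]
  rw [← hpreS, hv, eLpNorm_top_smul_stPull_preimage hβ hR' z₀.1 z₀.2 α u] at hconc
  have hα0 : ‖α‖ₑ ≠ 0 := by simp [hα.ne']
  have hS : eLpNorm (uncurry u) ⊤
      (volume.restrict (Ioo (z₀.1 - β * ρ' ^ 2) z₀.1 ×ˢ ball z₀.2 (R' * ρ'))) < ⊤ := by
    rcases ENNReal.mul_lt_top_iff.1 hconc with h2 | h0 | h0
    · exact h2.2
    · exact absurd h0 hα0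
    · rw [h0]; exact ENNReal.zero_lt_top
  have hsubS : parabolicCylinder (ε' * κ * r) z₀ ⊆
      Ioo (z₀.1 - β * ρ' ^ 2) z₀.1 ×ˢ ball z₀.2 (R' * ρ') := by
    rw [parabolicCylinder]
    refine prod_mono (Ioo_subset_Ioo ?_ le_rfl) (ball_subset_ball ?_)
    · -- `(ε'κr)² ≤ βρ'² = θ²ε'²r²/ν`, i.e. `κ²ν ≤ θ²`
      have e : β * ρ' ^ 2 = (ε' * r) ^ 2 * (θ ^ 2 / ν) := by
        rw [hρ', hβdef, hR'def]; field_simp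
      have hk : κ ^ 2 * ν ≤ θ ^ 2 := by
        have h1 : (κ * Real.sqrt ν) ^ 2 ≤ θ ^ 2 :=
          pow_le_pow_left₀ (by positivity) hκ4 2
        rwa [mul_pow, Real.sq_sqrt hν.le] at h1
      have : (ε' * κ * r) ^ 2 ≤ β * ρ' ^ 2 := by
        rw [e, show (ε' * κ * r) ^ 2 = (ε' * r) ^ 2 * κ ^ 2 by ring]
        gcongr
        rwa [le_div_iff₀ hν]
      linarith
    · -- `ε'κr ≤ R'ρ' = θε'r`
      rw [hρ', hR'def]
      have e : θ * R * (ε' * (r / R)) = ε' * θ * r := by field_simp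
      rw [e]
      have : ε' * κ * r ≤ ε' * θ * r := by gcongr
      exact this
  exact (eLpNorm_mono_measure (uncurry u) (Measure.restrict_mono hsubS le_rfl)).trans_lt hS

end Viscosity

end Literature.Analysis.FluidPDE

end
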